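import Literature.Probability.LatticeModels.GibbsSpecificationTiltedRatio
import Literature.MathematicalPhysics.QuantumLattice.TorusWilsonGibbs
import HarnessLib

/-!
# Gibbsian specifications with SITE-DEPENDENT a priori measures

Companion ("theorems only") file of `GibbsSpecificationTilted.lean` /
`GibbsSpecificationTiltedRatio.lean`. Those files treat the Gibbsian kernels
`γ_Λ(· | η) = ((ν^{⊗Λ}) ∘ glueWith⁻¹(·, η)).tilted φ_Λ` with ONE a priori measure `ν` at every
site. Joint systems of several kinds of variables (spins together with auxiliary marks, as in
decoupling / random-cluster type representations of a perturbed Gibbs measure) carry a different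
reference measure at each site. This file records the same facts for a family
`ν : V → Measure S` of nonzero finite a priori measures, with the reference measure of the volume
`Λ` the product `Measure.pi fun v : Λ => ν v` (Mathlib's marginal `lmarginal ν Λ` is already of
this generality, so the proofs are those of the one-measure case verbatim):

* `isSpecification_tilted_map_glueWith_pi_hetero` — probability, `𝓕_{Λᶜ}`-measurability,
  properness, consistency (Georgii's `IsSpecification`) for bounded measurable volume energies
  `φ_Λ` with `φ_{Λ'} - φ_Λ` not depending on the spins in `Λ ⊆ Λ'` (Friedli–Velenik 2017, §6.10.1
  with Lemma 6.15; Georgii 2011, Def. 1.23 / Def. 2.9: λ-specifications with a reference measure,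
  whose site-dependence is immaterial to the proof);
* `map_glueWith_univ_pi_hetero` — on a finite site set the full-volume glued reference measure is
  the product measure `Measure.pi ν`;
* `integral_glued_tilted_le_exp_mul_hetero`, `integral_glued_tilted_eq_hetero` — comparison
  (ratio `e^{2ε}`) and equality of two glued tilted kernels whose pulled-back energies differ by a
  constant up to `ε` (resp. exactly), for observables not distinguishing the two exteriors.

## References

* S. Friedli, Y. Velenik, *Statistical Mechanics of Lattice Systems* (CUP 2017), §6.3.2
  Lemma 6.15, §6.10.1 eqs. (6.109)–(6.111).
* H.-O. Georgii, *Gibbs Measures and Phase Transitions*, 2nd ed. (de Gruyter 2011), Def. 1.23,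
  Def. 2.9.
-/

noncomputable section

open MeasureTheory Finset Function
open scoped ENNReal

namespace Literature.Probability.LatticeModels

section TiltedGlueHetero

variable {V S : Type*} [MeasurableSpace S]

/-- The glued site-dependent reference measure `(⊗_{v ∈ Λ} ν_v) ∘ glueWith⁻¹(·, η)` is nonzero
when every `ν_v` is a nonzero finite measure (its mass is `∏_{v ∈ Λ} ν_v(S) ≠ 0`).
[cite: Georgii2011, Def. 2.9] -/
theorem map_glueWith_pi_ne_zero_hetero (ν : V → Measure S) [∀ v, IsFiniteMeasure (ν v)]
    (hν : ∀ v, ν v ≠ 0) (Λ : Finset V) (η : V → S) :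
    (Measure.pi fun v : Λ => ν v).map (glueWith Λ · η) ≠ 0 := by
  rw [Measure.map_ne_zero_iff (measurable_glueWith Λ η).aemeasurable]
  intro h
  have h1 := congrArg (fun m : Measure (Λ → S) => m Set.univ) h
  simp only [Measure.pi_univ, Measure.coe_zero, Pi.zero_apply, Finset.prod_eq_zero_iff,
    Measure.measure_univ_eq_zero] at h1
  obtain ⟨v, -, h2⟩ := h1
  exact hν v h2

/-- For a bounded measurable energy `φ`, the Boltzmann factor `exp φ` is integrable against the
glued site-dependent reference measure of finite a priori measures.
[cite: FriedliVelenik2017, §6.10.1 eq. (6.110)] -/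
theorem integrable_exp_map_glueWith_pi_hetero (ν : V → Measure S) [∀ v, IsFiniteMeasure (ν v)]
    (Λ : Finset V) (η : V → S) {φ : (V → S) → ℝ} (hφm : Measurable φ)
    (hφb : ∃ C, ∀ σ, |φ σ| ≤ C) :
    Integrable (fun σ => Real.exp (φ σ)) ((Measure.pi fun v : Λ => ν v).map (glueWith Λ · η)) := by
  obtain ⟨C, hC⟩ := hφb
  refine Integrable.of_bound hφm.exp.aestronglyMeasurable (Real.exp C)
    (ae_of_all _ fun σ => ?_)
  rw [Real.norm_eq_abs, Real.abs_exp, Real.exp_le_exp]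
  exact (le_abs_self _).trans (hC σ)

/-- With nonzero finite a priori measures and a bounded measurable energy, the Gibbsian kernel
`((⊗_{v∈Λ} ν_v) ∘ glueWith⁻¹).tilted φ` is a probability measure.
[cite: FriedliVelenik2017, §6.10.1 eq. (6.110)] -/
theorem isProbabilityMeasure_tilted_map_glueWith_pi_hetero (ν : V → Measure S)
    [∀ v, IsFiniteMeasure (ν v)] (hν : ∀ v, ν v ≠ 0) (Λ : Finset V) (η : V → S)
    {φ : (V → S) → ℝ} (hφm : Measurable φ) (hφb : ∃ C, ∀ σ, |φ σ| ≤ C) :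
    IsProbabilityMeasure (((Measure.pi fun v : Λ => ν v).map (glueWith Λ · η)).tilted φ) := by
  haveI : NeZero ((Measure.pi fun v : Λ => ν v).map (glueWith Λ · η)) :=
    ⟨map_glueWith_pi_ne_zero_hetero ν hν Λ η⟩
  exact isProbabilityMeasure_tilted (integrable_exp_map_glueWith_pi_hetero ν Λ η hφm hφb)

/-- **Properness** (countable site set): almost every configuration under the glued tilted
kernel agrees with the boundary condition off `Λ`. [cite: FriedliVelenik2017, §6.10.1 eq. (6.111)] -/
theorem ae_eq_of_not_mem_tilted_map_glueWith_pi_hetero [Countable V] [MeasurableSingletonClass S]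
    (ν : V → Measure S) (Λ : Finset V) (η : V → S) (φ : (V → S) → ℝ) :
    ∀ᵐ σ ∂(((Measure.pi fun v : Λ => ν v).map (glueWith Λ · η)).tilted φ),
      ∀ x ∉ Λ, σ x = η x := by
  have hS : MeasurableSet {σ : V → S | ∀ x ∉ Λ, σ x = η x} := by
    have : {σ : V → S | ∀ x ∉ Λ, σ x = η x} =
        ⋂ x ∈ ((↑Λ : Set V)ᶜ), (fun σ : V → S => σ x) ⁻¹' {η x} := by
      ext σ; simp
    rw [this]
    exact MeasurableSet.biInter (Set.to_countable _) fun x _ =>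
      measurable_pi_apply x (measurableSet_singleton _)
  have href : ∀ᵐ σ ∂((Measure.pi fun v : Λ => ν v).map (glueWith Λ · η)),
      ∀ x ∉ Λ, σ x = η x := by
    rw [ae_map_iff (measurable_glueWith Λ η).aemeasurable hS]
    exact ae_of_all _ fun ζ x hx => glueWith_apply_not_mem Λ ζ η hx
  exact href.filter_mono (tilted_absolutelyContinuous _ _).ae_le

variable [DecidableEq V]

/-- Integration against the glued site-dependent reference measure is Mathlib's marginal
`lmarginal ν Λ` evaluated at the boundary condition. [cite: FriedliVelenik2017, §6.10.1 eq. (6.110)] -/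
theorem lintegral_map_glueWith_pi_eq_lmarginal_hetero (ν : V → Measure S) (Λ : Finset V)
    (η : V → S) {F : (V → S) → ℝ≥0∞} (hF : Measurable F) :
    ∫⁻ σ, F σ ∂((Measure.pi fun v : Λ => ν v).map (glueWith Λ · η)) = lmarginal ν Λ F η := by
  rw [lintegral_map hF (measurable_glueWith Λ η)]
  simp only [lmarginal, glueWith_eq_updateFinset]

/-- The normaliser as a marginal: `∫⋯∫⁻_Λ exp φ = ofReal Z_Λ(η)`.
[cite: FriedliVelenik2017, §6.10.1 eq. (6.110)] -/
theorem lmarginal_ofReal_exp_eq_ofReal_integral_hetero (ν : V → Measure S)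
    [∀ v, IsFiniteMeasure (ν v)] (Λ : Finset V) (η : V → S) {φ : (V → S) → ℝ}
    (hφm : Measurable φ) (hφb : ∃ C, ∀ σ, |φ σ| ≤ C) :
    lmarginal ν Λ (fun σ => ENNReal.ofReal (Real.exp (φ σ))) η =
      ENNReal.ofReal (∫ σ, Real.exp (φ σ) ∂((Measure.pi fun v : Λ => ν v).map (glueWith Λ · η))) := by
  rw [← lintegral_map_glueWith_pi_eq_lmarginal_hetero ν Λ η
      (F := fun σ => ENNReal.ofReal (Real.exp (φ σ))) hφm.exp.ennreal_ofReal,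
    ofReal_integral_eq_lintegral_ofReal (integrable_exp_map_glueWith_pi_hetero ν Λ η hφm hφb)
      (ae_of_all _ fun _ => (Real.exp_pos _).le)]

/-- The normaliser marginal is nonzero (nonzero finite a priori measures).
[cite: FriedliVelenik2017, §6.10.1 eq. (6.110)] -/
theorem lmarginal_ofReal_exp_ne_zero_hetero (ν : V → Measure S) [∀ v, IsFiniteMeasure (ν v)]
    (hν : ∀ v, ν v ≠ 0) (Λ : Finset V) (η : V → S) {φ : (V → S) → ℝ} (hφm : Measurable φ)
    (hφb : ∃ C, ∀ σ, |φ σ| ≤ C) :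
    lmarginal ν Λ (fun σ => ENNReal.ofReal (Real.exp (φ σ))) η ≠ 0 := by
  rw [lmarginal_ofReal_exp_eq_ofReal_integral_hetero ν Λ η hφm hφb]
  haveI : NeZero ((Measure.pi fun v : Λ => ν v).map (glueWith Λ · η)) :=
    ⟨map_glueWith_pi_ne_zero_hetero ν hν Λ η⟩
  exact (ENNReal.ofReal_pos.2
    (integral_exp_pos (integrable_exp_map_glueWith_pi_hetero ν Λ η hφm hφb))).ne'

/-- The normaliser marginal is finite (finite a priori measures, bounded energy).
[cite: FriedliVelenik2017, §6.10.1 eq. (6.110)] -/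
theorem lmarginal_ofReal_exp_ne_top_hetero (ν : V → Measure S) [∀ v, IsFiniteMeasure (ν v)]
    (Λ : Finset V) (η : V → S) {φ : (V → S) → ℝ} (hφm : Measurable φ)
    (hφb : ∃ C, ∀ σ, |φ σ| ≤ C) :
    lmarginal ν Λ (fun σ => ENNReal.ofReal (Real.exp (φ σ))) η ≠ ∞ := by
  rw [lmarginal_ofReal_exp_eq_ofReal_integral_hetero ν Λ η hφm hφb]
  exact ENNReal.ofReal_ne_top

/-- Integration against the glued tilted kernel is a ratio of marginals.
[cite: FriedliVelenik2017, §6.10.1 eq. (6.111)] -/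
theorem lintegral_tilted_map_glueWith_pi_hetero (ν : V → Measure S) [∀ v, IsFiniteMeasure (ν v)]
    (hν : ∀ v, ν v ≠ 0) (Λ : Finset V) (η : V → S) {φ : (V → S) → ℝ} (hφm : Measurable φ)
    (hφb : ∃ C, ∀ σ, |φ σ| ≤ C) {F : (V → S) → ℝ≥0∞} (hF : Measurable F) :
    ∫⁻ σ, F σ ∂(((Measure.pi fun v : Λ => ν v).map (glueWith Λ · η)).tilted φ) =
      lmarginal ν Λ (fun σ => ENNReal.ofReal (Real.exp (φ σ)) * F σ) η /
        lmarginal ν Λ (fun σ => ENNReal.ofReal (Real.exp (φ σ))) η := by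
  have hint := integrable_exp_map_glueWith_pi_hetero ν Λ η hφm hφb
  haveI : NeZero ((Measure.pi fun v : Λ => ν v).map (glueWith Λ · η)) :=
    ⟨map_glueWith_pi_ne_zero_hetero ν hν Λ η⟩
  have hZ : 0 < ∫ σ, Real.exp (φ σ) ∂((Measure.pi fun v : Λ => ν v).map (glueWith Λ · η)) :=
    integral_exp_pos hint
  have hw : Measurable fun σ : V → S => ENNReal.ofReal (Real.exp (φ σ)) :=
    hφm.exp.ennreal_ofReal
  rw [lmarginal_ofReal_exp_eq_ofReal_integral_hetero ν Λ η hφm hφb,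
    ← lintegral_map_glueWith_pi_eq_lmarginal_hetero ν Λ η
      (F := fun σ => ENNReal.ofReal (Real.exp (φ σ)) * F σ) (hw.mul hF), lintegral_tilted]
  have h1 : ∀ σ : V → S, ENNReal.ofReal (Real.exp (φ σ) /
      ∫ x, Real.exp (φ x) ∂((Measure.pi fun v : Λ => ν v).map (glueWith Λ · η))) * F σ =
      ENNReal.ofReal (Real.exp (φ σ)) * F σ *
        (ENNReal.ofReal (∫ x, Real.exp (φ x)
          ∂((Measure.pi fun v : Λ => ν v).map (glueWith Λ · η))))⁻¹ := fun σ => by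
    rw [ENNReal.ofReal_div_of_pos hZ, div_eq_mul_inv, mul_right_comm]
  simp_rw [h1]
  rw [lintegral_mul_const' _ _ (ENNReal.inv_ne_top.2 (ENNReal.ofReal_pos.2 hZ).ne'), div_eq_mul_inv]

/-- The glued tilted kernel on a measurable set, as a ratio of marginals.
[cite: FriedliVelenik2017, §6.10.1 eq. (6.110)] -/
theorem tilted_map_glueWith_pi_apply_hetero (ν : V → Measure S) [∀ v, IsFiniteMeasure (ν v)]
    (hν : ∀ v, ν v ≠ 0) (Λ : Finset V) (η : V → S) {φ : (V → S) → ℝ} (hφm : Measurable φ)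
    (hφb : ∃ C, ∀ σ, |φ σ| ≤ C) {A : Set (V → S)} (hA : MeasurableSet A) :
    ((Measure.pi fun v : Λ => ν v).map (glueWith Λ · η)).tilted φ A =
      lmarginal ν Λ (fun σ => ENNReal.ofReal (Real.exp (φ σ)) * A.indicator 1 σ) η /
        lmarginal ν Λ (fun σ => ENNReal.ofReal (Real.exp (φ σ))) η := by
  rw [← lintegral_indicator_one hA,
    lintegral_tilted_map_glueWith_pi_hetero ν hν Λ η hφm hφb (measurable_one.indicator hA)]

/-- A marginal over the spins in `Λ` is measurable for the outside σ-algebra `𝓕_{Λᶜ}`.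
[cite: FriedliVelenik2017, §6.10.1 eq. (6.110)] -/
theorem measurable_cylinderEvents_lmarginal_hetero (ν : V → Measure S) [∀ v, SigmaFinite (ν v)]
    (Λ : Finset V) {F : (V → S) → ℝ≥0∞} (hF : Measurable F) :
    Measurable[cylinderEvents (X := fun _ : V => S) ((↑Λ : Set V)ᶜ)] (lmarginal ν Λ F) := by
  let c : ((((↑Λ : Set V)ᶜ : Set V) → S) × (↥Λ → S)) → (V → S) := fun p x =>
    if hx : x ∈ Λ then p.2 ⟨x, hx⟩ else p.1 ⟨x, by simpa using hx⟩
  have hc : Measurable c := measurable_pi_lambda _ fun x => by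
    by_cases hx : x ∈ Λ
    · simp only [c, hx, dite_true]
      exact (measurable_pi_apply _).comp measurable_snd
    · simp only [c, hx, dite_false]
      exact (measurable_pi_apply _).comp measurable_fst
  have hG : Measurable fun ρ : ((↑Λ : Set V)ᶜ : Set V) → S =>
      ∫⁻ ζ, F (c (ρ, ζ)) ∂(Measure.pi fun v : Λ => ν v) :=
    (hF.comp hc).lintegral_prod_right'
  have hfac : lmarginal ν Λ F =
      (fun ρ : ((↑Λ : Set V)ᶜ : Set V) → S =>
        ∫⁻ ζ, F (c (ρ, ζ)) ∂(Measure.pi fun v : Λ => ν v)) ∘ Set.restrict ((↑Λ : Set V)ᶜ) := by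
    funext η
    rfl
  rw [hfac]
  exact hG.comp (measurable_restrict_cylinderEvents _)

/-- `𝓕_{Λᶜ}`-measurability of the glued tilted kernels in the boundary condition.
[cite: FriedliVelenik2017, §6.10.1 eq. (6.110)] -/
theorem measurable_cylinderEvents_tilted_map_glueWith_pi_apply_hetero (ν : V → Measure S)
    [∀ v, IsFiniteMeasure (ν v)] (hν : ∀ v, ν v ≠ 0) (Λ : Finset V) {φ : (V → S) → ℝ}
    (hφm : Measurable φ) (hφb : ∃ C, ∀ σ, |φ σ| ≤ C) {A : Set (V → S)} (hA : MeasurableSet A) :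
    Measurable[cylinderEvents (X := fun _ : V => S) ((↑Λ : Set V)ᶜ)]
      fun η : V → S => ((Measure.pi fun v : Λ => ν v).map (glueWith Λ · η)).tilted φ A := by
  have hw : Measurable fun σ : V → S => ENNReal.ofReal (Real.exp (φ σ)) :=
    hφm.exp.ennreal_ofReal
  have hform : (fun η : V → S => ((Measure.pi fun v : Λ => ν v).map (glueWith Λ · η)).tilted φ A) =
      fun η => lmarginal ν Λ (fun σ => ENNReal.ofReal (Real.exp (φ σ)) * A.indicator 1 σ) η /
        lmarginal ν Λ (fun σ => ENNReal.ofReal (Real.exp (φ σ))) η :=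
    funext fun η => tilted_map_glueWith_pi_apply_hetero ν hν Λ η hφm hφb hA
  rw [hform]
  exact (measurable_cylinderEvents_lmarginal_hetero ν Λ (hw.mul (measurable_one.indicator hA))).div
    (measurable_cylinderEvents_lmarginal_hetero ν Λ hw)

/-- **Consistency** `γ_{Λ'} γ_Λ = γ_{Λ'}` (`Λ ⊆ Λ'`) of the glued tilted kernels with
site-dependent a priori measures, when `φ_{Λ'} - φ_Λ` does not depend on the spins in `Λ`
(Friedli–Velenik 2017, Lemma 6.15, integral form via the fibre identity
`lmarginal_mul_mul_eq_of_dependsOn`). [cite: FriedliVelenik2017, Lemma 6.15] -/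
theorem lintegral_tilted_map_glueWith_pi_consistent_hetero (ν : V → Measure S)
    [∀ v, IsFiniteMeasure (ν v)] (hν : ∀ v, ν v ≠ 0) {φ : Finset V → (V → S) → ℝ}
    (hφm : ∀ Λ, Measurable (φ Λ)) (hφb : ∀ Λ, ∃ C, ∀ σ, |φ Λ σ| ≤ C) {Λ Λ' : Finset V}
    (hsub : Λ ⊆ Λ') (hloc : DependsOn (fun σ => φ Λ' σ - φ Λ σ) ((↑Λ : Set V)ᶜ)) (η : V → S)
    {A : Set (V → S)} (hA : MeasurableSet A) :
    ∫⁻ σ, ((Measure.pi fun v : Λ => ν v).map (glueWith Λ · σ)).tilted (φ Λ) A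
        ∂(((Measure.pi fun v : Λ' => ν v).map (glueWith Λ' · η)).tilted (φ Λ')) =
      ((Measure.pi fun v : Λ' => ν v).map (glueWith Λ' · η)).tilted (φ Λ') A := by
  have hw : ∀ Δ, Measurable fun σ : V → S => ENNReal.ofReal (Real.exp (φ Δ σ)) := fun Δ =>
    (hφm Δ).exp.ennreal_ofReal
  have hind : Measurable (A.indicator (1 : (V → S) → ℝ≥0∞)) := measurable_one.indicator hA
  have hq : ∀ σ, ((Measure.pi fun v : Λ => ν v).map (glueWith Λ · σ)).tilted (φ Λ) A =
      lmarginal ν Λ (fun τ => ENNReal.ofReal (Real.exp (φ Λ τ)) * A.indicator 1 τ) σ /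
        lmarginal ν Λ (fun τ => ENNReal.ofReal (Real.exp (φ Λ τ))) σ :=
    fun σ => tilted_map_glueWith_pi_apply_hetero ν hν Λ σ (hφm Λ) (hφb Λ) hA
  have hqm : Measurable fun σ => lmarginal ν Λ
          (fun τ => ENNReal.ofReal (Real.exp (φ Λ τ)) * A.indicator 1 τ) σ /
        lmarginal ν Λ (fun τ => ENNReal.ofReal (Real.exp (φ Λ τ))) σ :=
    (((hw Λ).mul hind).lmarginal _).div ((hw Λ).lmarginal _)
  simp_rw [hq]
  rw [lintegral_tilted_map_glueWith_pi_hetero ν hν Λ' η (hφm Λ') (hφb Λ') hqm,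
    tilted_map_glueWith_pi_apply_hetero ν hν Λ' η (hφm Λ') (hφb Λ') hA]
  congr 1
  refine congrFun (lmarginal_eq_of_subset (μ := ν) hsub ((hw Λ').mul hqm)
    ((hw Λ').mul hind) ?_) η
  have hsplit : ∀ σ : V → S, ENNReal.ofReal (Real.exp (φ Λ' σ)) =
      ENNReal.ofReal (Real.exp (φ Λ σ)) * ENNReal.ofReal (Real.exp (φ Λ' σ - φ Λ σ)) :=
    fun σ => by
      rw [← ENNReal.ofReal_mul (Real.exp_pos _).le, ← Real.exp_add, add_sub_cancel]
  simp_rw [hsplit]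
  refine lmarginal_mul_mul_eq_of_dependsOn ν Λ (hw Λ) hind
    (fun x y hxy => by simp only [hloc hxy]) ?_ fun ρ => ?_
  · intro x y hxy
    simp only
    rw [lmarginal_congr ν _ fun i hi => hxy i (by simpa using hi),
      lmarginal_congr ν (fun τ => ENNReal.ofReal (Real.exp (φ Λ τ)))
        fun i hi => hxy i (by simpa using hi)]
  · exact ENNReal.mul_div_cancel (lmarginal_ofReal_exp_ne_zero_hetero ν hν Λ ρ (hφm Λ) (hφb Λ))
      (lmarginal_ofReal_exp_ne_top_hetero ν Λ ρ (hφm Λ) (hφb Λ))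

/-- **Gibbsian specifications with site-dependent a priori measures are specifications**: for a
countable site set, a spin space with measurable singletons, nonzero finite a priori measures
`ν_v` and bounded measurable volume energies `φ_Λ` with `φ_{Λ'} - φ_Λ` not depending on the spins
in `Λ` whenever `Λ ⊆ Λ'`, the kernels `γ_Λ(· | η) = ((⊗_{v∈Λ} ν_v) ⊗ δ_{η_{Λᶜ}}).tilted φ_Λ`
satisfy Georgii's `IsSpecification` (Friedli–Velenik 2017, §6.10.1 with Lemma 6.15; Georgii 2011,
Def. 1.23 / Def. 2.9). [cite: FriedliVelenik2017, §6.10.1 eq. (6.110) with Lemma 6.15] -/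
theorem isSpecification_tilted_map_glueWith_pi_hetero [Countable V] [MeasurableSingletonClass S]
    (ν : V → Measure S) [∀ v, IsFiniteMeasure (ν v)] (hν : ∀ v, ν v ≠ 0)
    {φ : Finset V → (V → S) → ℝ} (hφm : ∀ Λ, Measurable (φ Λ))
    (hφb : ∀ Λ, ∃ C, ∀ σ, |φ Λ σ| ≤ C)
    (hloc : ∀ ⦃Λ Λ' : Finset V⦄, Λ ⊆ Λ' → DependsOn (fun σ => φ Λ' σ - φ Λ σ) ((↑Λ : Set V)ᶜ)) :
    IsSpecification
      (fun Λ η => ((Measure.pi fun v : Λ => ν v).map (glueWith Λ · η)).tilted (φ Λ)) where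
  isProbability Λ η := isProbabilityMeasure_tilted_map_glueWith_pi_hetero ν hν Λ η (hφm Λ) (hφb Λ)
  measurable Λ _ hA :=
    measurable_cylinderEvents_tilted_map_glueWith_pi_apply_hetero ν hν Λ (hφm Λ) (hφb Λ) hA
  proper Λ η := ae_eq_of_not_mem_tilted_map_glueWith_pi_hetero ν Λ η (φ Λ)
  consistent _ _ h η _ hA :=
    lintegral_tilted_map_glueWith_pi_consistent_hetero ν hν hφm hφb h (hloc h) η hA

end TiltedGlueHetero

/-! ### The full volume of a finite site set; comparison of two glued tilted kernels -/

section FullVolume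

variable {V S : Type*} [MeasurableSpace S]

/-- Gluing a configuration of the WHOLE finite site set with any boundary condition carries the
product `⊗_{v ∈ univ} ν_v` to the product measure `Measure.pi ν`. [cite: Georgii2011, §1.2] -/
theorem map_glueWith_univ_pi_hetero [Fintype V] (ν : V → Measure S) [∀ v, SigmaFinite (ν v)]
    (η : V → S) :
    (Measure.pi fun v : ↥(Finset.univ : Finset V) => ν v).map (glueWith Finset.univ · η) =
      Measure.pi ν := by
  symm
  refine Measure.pi_eq fun s hs => ?_
  rw [Measure.map_apply (measurable_glueWith _ η) (MeasurableSet.univ_pi hs)]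
  have hpre : (glueWith Finset.univ · η) ⁻¹' Set.pi Set.univ s =
      Set.pi Set.univ fun i : ↥(Finset.univ : Finset V) => s i := by
    ext ζ
    simp only [Set.mem_preimage, Set.mem_univ_pi]
    constructor
    · intro h i
      have := h i
      rwa [glueWith_apply_mem _ _ _ (Finset.mem_univ (i : V))] at this
    · intro h i
      rw [glueWith_apply_mem _ _ _ (Finset.mem_univ i)]
      exact h ⟨i, Finset.mem_univ i⟩
  rw [hpre, Measure.pi_pi]
  exact Finset.prod_coe_sort Finset.univ fun i => ν i (s i)

/-- **Comparison of two glued tilted kernels with site-dependent probability a priori measures**: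
if the pulled-back energies differ by a constant up to `ε` and the `[0,1]`-valued observable `f`
does not distinguish the two glued configurations, the kernel expectations agree up to the factor
`e^{2ε}`. [folklore] -/
theorem integral_glued_tilted_le_exp_mul_hetero (ν : V → Measure S)
    [∀ v, IsProbabilityMeasure (ν v)] (Λ : Finset V) (ζ₁ ζ₂ : V → S) {Φ₁ Φ₂ : (V → S) → ℝ}
    (hΦ₁ : Measurable Φ₁) (hΦ₂ : Measurable Φ₂) (hΦ₁b : ∃ C, ∀ σ, |Φ₁ σ| ≤ C)
    (hΦ₂b : ∃ C, ∀ σ, |Φ₂ σ| ≤ C) {f : (V → S) → ℝ} (hf : Measurable f)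
    (hf01 : ∀ σ, 0 ≤ f σ ∧ f σ ≤ 1)
    (hfζ : ∀ u : Λ → S, f (glueWith Λ u ζ₁) = f (glueWith Λ u ζ₂)) {c ε : ℝ}
    (h : ∀ u : Λ → S, |Φ₁ (glueWith Λ u ζ₁) - Φ₂ (glueWith Λ u ζ₂) - c| ≤ ε) :
    ∫ σ, f σ ∂(((Measure.pi fun v : Λ => ν v).map (glueWith Λ · ζ₁)).tilted Φ₁) ≤
      Real.exp (2 * ε) *
        ∫ σ, f σ ∂(((Measure.pi fun v : Λ => ν v).map (glueWith Λ · ζ₂)).tilted Φ₂) := by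
  rw [integral_tilted_map_eq_integral_tilted_comp _ (measurable_glueWith Λ ζ₁) hΦ₁ hf,
    integral_tilted_map_eq_integral_tilted_comp _ (measurable_glueWith Λ ζ₂) hΦ₂ hf]
  simp_rw [hfζ]
  obtain ⟨C₁, hC₁⟩ := hΦ₁b
  obtain ⟨C₂, hC₂⟩ := hΦ₂b
  exact integral_tilted_le_exp_mul (Measure.pi fun v : Λ => ν v)
    (hΦ₁.comp (measurable_glueWith Λ ζ₁)) (hΦ₂.comp (measurable_glueWith Λ ζ₂))
    ⟨C₁, fun u => hC₁ _⟩ ⟨C₂, fun u => hC₂ _⟩ (hf.comp (measurable_glueWith Λ ζ₂))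
    (fun u => hf01 _) h

/-- **Equality of two glued tilted kernels** whose pulled-back energies differ by a constant, on
`[0,1]`-valued observables not distinguishing the two exteriors (the case `ε = 0` of
`integral_glued_tilted_le_exp_mul_hetero`, both ways). [folklore] -/
theorem integral_glued_tilted_eq_hetero (ν : V → Measure S) [∀ v, IsProbabilityMeasure (ν v)]
    (Λ : Finset V) (ζ₁ ζ₂ : V → S) {Φ₁ Φ₂ : (V → S) → ℝ} (hΦ₁ : Measurable Φ₁)
    (hΦ₂ : Measurable Φ₂) (hΦ₁b : ∃ C, ∀ σ, |Φ₁ σ| ≤ C) (hΦ₂b : ∃ C, ∀ σ, |Φ₂ σ| ≤ C)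
    {f : (V → S) → ℝ} (hf : Measurable f) (hf01 : ∀ σ, 0 ≤ f σ ∧ f σ ≤ 1)
    (hfζ : ∀ u : Λ → S, f (glueWith Λ u ζ₁) = f (glueWith Λ u ζ₂)) {c : ℝ}
    (h : ∀ u : Λ → S, Φ₁ (glueWith Λ u ζ₁) - Φ₂ (glueWith Λ u ζ₂) = c) :
    ∫ σ, f σ ∂(((Measure.pi fun v : Λ => ν v).map (glueWith Λ · ζ₁)).tilted Φ₁) =
      ∫ σ, f σ ∂(((Measure.pi fun v : Λ => ν v).map (glueWith Λ · ζ₂)).tilted Φ₂) := by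
  have h1 := integral_glued_tilted_le_exp_mul_hetero ν Λ ζ₁ ζ₂ hΦ₁ hΦ₂ hΦ₁b hΦ₂b hf hf01 hfζ
    (c := c) (ε := 0) fun u => by rw [h u, sub_self, abs_zero]
  have h2 := integral_glued_tilted_le_exp_mul_hetero ν Λ ζ₂ ζ₁ hΦ₂ hΦ₁ hΦ₂b hΦ₁b hf hf01
    (fun u => (hfζ u).symm) (c := -c) (ε := 0) fun u => by
      have := h u
      rw [show Φ₂ (glueWith Λ u ζ₂) - Φ₁ (glueWith Λ u ζ₁) - -c =
        -(Φ₁ (glueWith Λ u ζ₁) - Φ₂ (glueWith Λ u ζ₂) - c) by ring, this, sub_self, neg_zero,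
        abs_zero]
  rw [mul_zero, Real.exp_zero, one_mul] at h1 h2
  exact le_antisymm h1 h2

end FullVolume

end Literature.Probability.LatticeModels

end
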